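import Summits.AtomisticToContinuum.BoseEinsteinCondensation.Theses.BECStronglyRayleigh
import Summits.AtomisticToContinuum.BoseEinsteinCondensation.Theorems.BECStronglyRayleighStableImpliesPairCoherenceLorentz
import Literature.Combinatorics.StablePolynomials.KernelForm
import HarnessLib

/-!
# `StableImpliesPairCoherence`
# (support item stmt-AtomisticToContinuum-9675 of route BECStronglyRayleigh)

**Theorem.** Let `Λ` be finite, `N ≥ 2`, and `φ : Finset Λ → ℝ` nonnegative, supported on `N`-sets,
with `Σ_S φ(S) ∏_{x∈S} z_x ≠ 0` whenever all `Im z_x > 0`. With the two-particle insertion field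
`r^T_x = Σ_y [x,y ∉ T, x ≠ y] φ(T ∪ {x,y})` and `R_T = Σ_x r^T_x`,
`N(N-1) Σ_S φ(S)² ≤ Σ_{|T| = N-2} [ Σ_x (r^T_x)³/R_T + (Σ_x (r^T_x)²)²/R_T² ]`.

Proof (all in function form, no `MvPolynomial` manipulation):
* `derivCoeff_stable_or_zero` — the coefficient family `S' ↦ [S' ∩ T = ∅] φ(S' ∪ T)` of `∂^T p`
  is zero or stable: the kernel form of Borcea–Brändén's Lemma 2.2
  (`Literature.Combinatorics.StablePolynomials.multiAffine_kernel_stable_or_zero`) for the operator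
  `∂^T`, whose symbol is `∏_{i ∉ T} (zᵢ + wᵢ)` (`Finset.prod_add`);
* `sum_sum_ite_insert_insert` — ordered pairs off `T` versus `2`-subsets of `Tᶜ`, whence
  (`pairKernel_zero_or_stable`) the pair kernel `K_T(x,y) = [x,y ∉ T, x ≠ y] φ(T ∪ {x,y})` is zero
  or its quadratic form `zᵀK_T z = 2 ∂^T p(z)` has no zero in `H^Λ`;
* `sum_sq_le_of_quadratic_stable` (file `…StableImpliesPairCoherenceLorentz`) — the Lorentzian
  Frobenius bound `‖K_T‖_F² ≤ Σ_x (r^T_x)³/R_T + ‖r^T‖⁴/R_T²` for each `T`;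
* `sum_pairKernel_sq` — the double count `Σ_{|T|=N-2} ‖K_T‖_F² = N(N-1) Σ_S φ(S)²`
  (`T ↦ T ∪ {x,y}` is a bijection onto the sets containing `x ≠ y`; an `N`-set has `N(N-1)` ordered
  pairs).
The closing theorem is `stableImpliesPairCoherence`, with the `Theorems`-namespace alias
`Summit.AtomisticToContinuum.BoseEinsteinCondensation.Theorems.StableImpliesPairCoherence_proof`.

References: P. Brändén, J. Huh, *Lorentzian polynomials* (arXiv:1902.03719), §1, Prop. 1.2 and
Lemma 1.5 [BrandenHuh2019]; J. Borcea, P. Brändén, Invent. Math. 177 (2009), §2.1, Lemma 2.2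
[BorceaBranden2009].
-/

noncomputable section

namespace Summit.AtomisticToContinuum.BoseEinsteinCondensation.Theorems.PairCoherence

open Finset
open scoped BigOperators

variable {Λ : Type*} [Fintype Λ] [DecidableEq Λ]

/-- **Ordered pairs off `T` versus `2`-subsets of `Tᶜ`.** For any `F`,
`Σₓ Σ_y [x ∉ T, y ∉ T, x ≠ y] F(T ∪ {x,y}) = Σ_{S ⊆ Tᶜ, |S| = 2} 2 • F(S ∪ T)` (each unordered pair
is hit by two ordered pairs). [folklore] -/
theorem sum_sum_ite_insert_insert {M : Type*} [AddCommMonoid M] (T : Finset Λ) (F : Finset Λ → M) :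
    ∑ x, ∑ y, (if x ∉ T ∧ y ∉ T ∧ x ≠ y then F (insert x (insert y T)) else 0) =
      ∑ S ∈ (Tᶜ).powersetCard 2, 2 • F (S ∪ T) := by
  have hR : ∀ S ∈ (Tᶜ).powersetCard 2, 2 • F (S ∪ T) = ∑ _x ∈ S, F (S ∪ T) := by
    intro S hS
    rw [Finset.sum_const, (Finset.mem_powersetCard.1 hS).2]
  have inner : ∀ x, (∑ y, if x ∉ T ∧ y ∉ T ∧ x ≠ y then F (insert x (insert y T)) else 0) =
      ∑ S ∈ ((Tᶜ).powersetCard 2).filter (fun S => x ∈ S), F (S ∪ T) := by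
    intro x
    rw [← Finset.sum_filter]
    refine Finset.sum_bij (fun y _ => ({x, y} : Finset Λ)) ?_ ?_ ?_ ?_
    · intro y hy
      simp only [Finset.mem_filter, Finset.mem_univ, true_and] at hy
      obtain ⟨hx, hy, hxy⟩ := hy
      simp only [Finset.mem_filter, Finset.mem_powersetCard, Finset.mem_insert,
        Finset.mem_singleton, true_or, and_true]
      refine ⟨fun a ha => ?_, Finset.card_pair hxy⟩
      simp only [Finset.mem_insert, Finset.mem_singleton] at ha
      rw [Finset.mem_compl]
      rcases ha with rfl | rfl <;> assumption
    · intro y hy y' hy' h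
      simp only [Finset.mem_filter, Finset.mem_univ, true_and] at hy
      have : y ∈ ({x, y'} : Finset Λ) := by rw [← h]; simp
      simp only [Finset.mem_insert, Finset.mem_singleton] at this
      rcases this with h1 | h1
      · exact absurd h1.symm hy.2.2
      · exact h1
    · intro S hS
      simp only [Finset.mem_filter, Finset.mem_powersetCard] at hS
      obtain ⟨⟨hST, hcard⟩, hxS⟩ := hS
      obtain ⟨a, b, hab, rfl⟩ := Finset.card_eq_two.1 hcard
      simp only [Finset.mem_insert, Finset.mem_singleton] at hxS
      have haT : a ∉ T := Finset.mem_compl.1 (hST (by simp))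
      have hbT : b ∉ T := Finset.mem_compl.1 (hST (by simp))
      rcases hxS with rfl | rfl
      · exact ⟨b, by simp [haT, hbT, hab], rfl⟩
      · exact ⟨a, by simp [haT, hbT, hab.symm], Finset.pair_comm _ _⟩
    · intro y _
      rw [Finset.insert_union, ← Finset.insert_eq]
  calc (∑ x, ∑ y, (if x ∉ T ∧ y ∉ T ∧ x ≠ y then F (insert x (insert y T)) else 0))
      = ∑ x, ∑ S ∈ ((Tᶜ).powersetCard 2).filter (fun S => x ∈ S), F (S ∪ T) :=
        Finset.sum_congr rfl fun x _ => inner x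
    _ = ∑ S ∈ (Tᶜ).powersetCard 2, ∑ _x ∈ S, F (S ∪ T) := by
        refine Finset.sum_comm' fun x S => ?_
        simp only [Finset.mem_filter, Finset.mem_univ, true_and]
        tauto
    _ = ∑ S ∈ (Tᶜ).powersetCard 2, 2 • F (S ∪ T) := Finset.sum_congr rfl fun S hS => (hR S hS).symm

/-- Collapsing the kernel of `∂^T` (`K S' S = [S' ∩ T = ∅, S = S' ∪ T]`) against a function.
[folklore] -/
theorem sum_derivKernel_mul (T S' : Finset Λ) (f : Finset Λ → ℂ) :
    ∑ S, (if Disjoint S' T ∧ S = S' ∪ T then (1 : ℂ) else 0) * f S =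
      if Disjoint S' T then f (S' ∪ T) else 0 := by
  by_cases h : Disjoint S' T
  · simp only [h, true_and, if_true, boole_mul, Finset.sum_ite_eq', Finset.mem_univ]
  · simp [h]

/-- **`∂^T p` is stable or zero, in function form.** If `Σ_S φ(S) z^S` has no zero in `H^Λ`, then
the coefficient family `S' ↦ [S' ∩ T = ∅] φ(S' ∪ T)` of `∂^T Σ_S φ(S) z^S` is identically zero or
its generating polynomial again has no zero in `H^Λ`. Obtained from the kernel form of Borcea–Brändén's
Lemma 2.2 (`multiAffine_kernel_stable_or_zero`) for the operator `∂^T = T_K`,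
`K S' S = [S' ∩ T = ∅, S = S' ∪ T]`, whose symbol is `∏_{i ∉ T} (zᵢ + wᵢ)`.
[cite: BorceaBranden2009, §2.1, Lemma 2.2] -/
theorem derivCoeff_stable_or_zero (T : Finset Λ) {φ : Finset Λ → ℝ}
    (hstab : ∀ z : Λ → ℂ, (∀ x, 0 < (z x).im) → (∑ S : Finset Λ, (φ S : ℂ) * ∏ x ∈ S, z x) ≠ 0) :
    (∀ S', (if Disjoint S' T then (φ (S' ∪ T) : ℂ) else 0) = 0) ∨
      ∀ z : Λ → ℂ, (∀ i, 0 < (z i).im) →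
        (∑ S', (if Disjoint S' T then (φ (S' ∪ T) : ℂ) else 0) * ∏ i ∈ S', z i) ≠ 0 := by
  have key := Literature.Combinatorics.StablePolynomials.multiAffine_kernel_stable_or_zero
    (σ := Λ) (fun S' S => if Disjoint S' T ∧ S = S' ∪ T then (1 : ℂ) else 0) ?_
    (a := fun S => (φ S : ℂ)) hstab
  · have e : ∀ S', (∑ S, (if Disjoint S' T ∧ S = S' ∪ T then (1 : ℂ) else 0) * (φ S : ℂ)) =
        if Disjoint S' T then (φ (S' ∪ T) : ℂ) else 0 := fun S' =>
      sum_derivKernel_mul T S' (fun S => (φ S : ℂ))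
    simp only [e] at key
    exact key
  · -- the symbol is `∏_{i ∉ T} (z i + w i)`, which does not vanish on `H × H`
    intro z w hz hw
    have e : (∑ S : Finset Λ, (∑ S' : Finset Λ,
        (if Disjoint S' T ∧ S = S' ∪ T then (1 : ℂ) else 0) * ∏ i ∈ S', z i) * ∏ i ∈ Sᶜ, w i) =
        ∏ i ∈ Tᶜ, (z i + w i) := by
      calc (∑ S : Finset Λ, (∑ S' : Finset Λ,
            (if Disjoint S' T ∧ S = S' ∪ T then (1 : ℂ) else 0) * ∏ i ∈ S', z i) * ∏ i ∈ Sᶜ, w i)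
          = ∑ S' : Finset Λ, ∑ S : Finset Λ, (if Disjoint S' T ∧ S = S' ∪ T then (1 : ℂ) else 0) *
              ((∏ i ∈ S', z i) * ∏ i ∈ Sᶜ, w i) := by
            simp only [Finset.sum_mul, mul_assoc]
            exact Finset.sum_comm
        _ = ∑ S' : Finset Λ, if Disjoint S' T then (∏ i ∈ S', z i) * ∏ i ∈ (S' ∪ T)ᶜ, w i else 0 :=
            Finset.sum_congr rfl fun S' _ =>
              sum_derivKernel_mul T S' (fun S => (∏ i ∈ S', z i) * ∏ i ∈ Sᶜ, w i)
        _ = ∑ S' ∈ (Tᶜ).powerset, (∏ i ∈ S', z i) * ∏ i ∈ Tᶜ \ S', w i := by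
            rw [← Finset.sum_filter]
            refine Finset.sum_congr ?_ fun S' hS' => ?_
            · ext S'
              simp [Finset.mem_powerset, Finset.subset_compl_iff_disjoint_right]
            · rw [Finset.mem_powerset, Finset.subset_compl_iff_disjoint_right] at hS'
              congr 1
              refine Finset.prod_congr ?_ fun _ _ => rfl
              ext i
              simp only [Finset.mem_compl, Finset.mem_union, Finset.mem_sdiff]
              tauto
        _ = ∏ i ∈ Tᶜ, (z i + w i) := (Finset.prod_add _ _ _).symm
    rw [e]
    refine Finset.prod_ne_zero_iff.2 fun i _ h0 => ?_
    have := congrArg Complex.im h0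
    simp only [Complex.add_im, Complex.zero_im] at this
    linarith [hz i, hw i]

/-- **Stability of the pair form.** Under the hypotheses of `StableImpliesPairCoherence`, for every
`T` with `|T| = N - 2` the pair kernel `K_T(x,y) = [x,y ∉ T, x ≠ y] φ(T ∪ {x,y})` is identically
zero or its quadratic form `Σ_{x,y} K_T(x,y) z_x z_y = 2 ∂^T p (z)` has no zero in `H^Λ`.
[cite: BrandenHuh2019, §1, Prop. 1.2] -/
theorem pairKernel_zero_or_stable {N : ℕ} (hN : 2 ≤ N) {φ : Finset Λ → ℝ}
    (hφN : ∀ S, S.card ≠ N → φ S = 0)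
    (hstab : ∀ z : Λ → ℂ, (∀ x, 0 < (z x).im) → (∑ S : Finset Λ, (φ S : ℂ) * ∏ x ∈ S, z x) ≠ 0)
    {T : Finset Λ} (hT : T.card = N - 2) :
    (∀ x y, (if x ∉ T ∧ y ∉ T ∧ x ≠ y then φ (insert x (insert y T)) else 0) = 0) ∨
      ∀ z : Λ → ℂ, (∀ i, 0 < (z i).im) →
        (∑ i, ∑ j, ((if i ∉ T ∧ j ∉ T ∧ i ≠ j then φ (insert i (insert j T)) else 0 : ℝ) : ℂ) *
          z i * z j) ≠ 0 := by
  rcases derivCoeff_stable_or_zero T hstab with h0 | hst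
  · refine Or.inl fun x y => ?_
    split_ifs with h
    · obtain ⟨hx, hy, hxy⟩ := h
      have := h0 {x, y}
      rw [if_pos (by simp [Finset.disjoint_insert_left, hx, hy]), Finset.insert_union,
        ← Finset.insert_eq] at this
      exact_mod_cast this
    · rfl
  · refine Or.inr fun z hz => ?_
    -- `F S = φ(S) z^{S ∖ T}`; the quadratic form is
    -- `2 Σ_{S' ⊆ Tᶜ, |S'| = 2} F(S' ∪ T) = 2 ∂^T p(z)`
    set F : Finset Λ → ℂ := fun S => (φ S : ℂ) * ∏ k ∈ S \ T, z k with hF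
    have hQ : (∑ i, ∑ j,
        ((if i ∉ T ∧ j ∉ T ∧ i ≠ j then φ (insert i (insert j T)) else 0 : ℝ) : ℂ) *
        z i * z j) = ∑ S ∈ (Tᶜ).powersetCard 2, 2 • F (S ∪ T) := by
      rw [← sum_sum_ite_insert_insert T F]
      refine Finset.sum_congr rfl fun i _ => Finset.sum_congr rfl fun j _ => ?_
      split_ifs with h
      · obtain ⟨hi, hj, hij⟩ := h
        have hsd : insert i (insert j T) \ T = {i, j} := by
          rw [Finset.insert_sdiff_of_notMem _ hi, Finset.insert_sdiff_of_notMem _ hj,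
            Finset.sdiff_self, Finset.insert_empty]
        simp only [hF, hsd, Finset.prod_pair hij]
        ring
      · simp
    have hP : (∑ S', (if Disjoint S' T then (φ (S' ∪ T) : ℂ) else 0) * ∏ i ∈ S', z i) =
        ∑ S ∈ (Tᶜ).powersetCard 2, F (S ∪ T) := by
      have e1 : ∀ S' : Finset Λ, (if Disjoint S' T then (φ (S' ∪ T) : ℂ) else 0) * ∏ i ∈ S', z i =
          if Disjoint S' T ∧ S'.card = 2 then F (S' ∪ T) else 0 := by
        intro S'
        by_cases hd : Disjoint S' T
        · by_cases hc : S'.card = 2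
          · simp only [hd, hc, and_self, if_true, hF, Finset.union_sdiff_cancel_right hd]
          · have : φ (S' ∪ T) = 0 := by
              refine hφN _ fun h => hc ?_
              rw [Finset.card_union_of_disjoint hd, hT] at h
              omega
            simp [this, hc]
        · simp [hd]
      simp only [e1]
      rw [← Finset.sum_filter]
      refine Finset.sum_congr ?_ fun _ _ => rfl
      ext S'
      simp [Finset.mem_powersetCard, Finset.subset_compl_iff_disjoint_right]
    rw [hQ]
    have h2 : (∑ S ∈ (Tᶜ).powersetCard 2, 2 • F (S ∪ T)) =
        2 * ∑ S ∈ (Tᶜ).powersetCard 2, F (S ∪ T) := by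
      rw [Finset.mul_sum]
      exact Finset.sum_congr rfl fun S _ => by rw [two_smul, two_mul]
    rw [h2, ← hP]
    exact mul_ne_zero two_ne_zero (hst z hz)

/-- **Frobenius double count.** For `φ` supported on `N`-sets, `N ≥ 2`:
`Σ_{|T| = N-2} Σ_{x,y} K_T(x,y)² = N(N-1) Σ_S φ(S)²` — each `N`-set `S` is `T ∪ {x,y}` for exactly
`N(N-1)` triples `(T, x, y)`. [folklore] -/
theorem sum_pairKernel_sq {N : ℕ} (hN : 2 ≤ N) {φ : Finset Λ → ℝ}
    (hφN : ∀ S, S.card ≠ N → φ S = 0) :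
    ∑ T ∈ (univ : Finset Λ).powersetCard (N - 2), ∑ x, ∑ y,
        (if x ∉ T ∧ y ∉ T ∧ x ≠ y then φ (insert x (insert y T)) else 0) ^ 2 =
      (N : ℝ) * ((N : ℝ) - 1) * ∑ S, φ S ^ 2 := by
  -- the card of `T ∪ {x, y}`
  have hcard : ∀ (T : Finset Λ) (x y : Λ), x ∉ T → y ∉ T → x ≠ y →
      (insert x (insert y T)).card = T.card + 2 := by
    intro T x y hx hy hxy
    rw [Finset.card_insert_of_notMem (by simp [hx, hxy]), Finset.card_insert_of_notMem hy]
  -- Step 1: all `T` (the other terms vanish by the support condition)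
  have h1 : ∑ T ∈ (univ : Finset Λ).powersetCard (N - 2), ∑ x, ∑ y,
        (if x ∉ T ∧ y ∉ T ∧ x ≠ y then φ (insert x (insert y T)) else 0) ^ 2 =
      ∑ T, ∑ x, ∑ y, (if x ∉ T ∧ y ∉ T ∧ x ≠ y then φ (insert x (insert y T)) ^ 2 else 0) := by
    rw [Finset.sum_subset (Finset.subset_univ ((univ : Finset Λ).powersetCard (N - 2)))]
    · refine Finset.sum_congr rfl fun T _ => Finset.sum_congr rfl fun x _ =>
        Finset.sum_congr rfl fun y _ => ?_
      split_ifs <;> simp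
    · intro T _ hT
      rw [Finset.mem_powersetCard_univ] at hT
      refine Finset.sum_eq_zero fun x _ => Finset.sum_eq_zero fun y _ => ?_
      split_ifs with h
      · rw [hφN _ fun hc => hT ?_, zero_pow two_ne_zero]
        rw [hcard T x y h.1 h.2.1 h.2.2] at hc
        omega
      · simp
  -- Step 2: for fixed `x ≠ y`, `T ↦ T ∪ {x, y}` is a bijection onto the sets containing `x, y`
  have h2 : ∀ x y, (∑ T, (if x ∉ T ∧ y ∉ T ∧ x ≠ y then φ (insert x (insert y T)) ^ 2 else 0)) =
      ∑ S, (if x ≠ y ∧ x ∈ S ∧ y ∈ S then φ S ^ 2 else 0) := by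
    intro x y
    by_cases hxy : x = y
    · simp [hxy]
    rw [← Finset.sum_filter, ← Finset.sum_filter]
    refine Finset.sum_nbij' (fun T => insert x (insert y T)) (fun S => (S.erase x).erase y)
      ?_ ?_ ?_ ?_ fun _ _ => rfl
    · intro T hT
      simp only [Finset.mem_filter, Finset.mem_univ, true_and] at hT ⊢
      simp [hxy]
    · intro S hS
      simp only [Finset.mem_filter, Finset.mem_univ, true_and] at hS ⊢
      simp [Finset.mem_erase, hxy]
    · intro T hT
      simp only [Finset.mem_filter, Finset.mem_univ, true_and] at hT
      rw [Finset.erase_insert (by simp [hT.1, hxy]), Finset.erase_insert hT.2.1]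
    · intro S hS
      simp only [Finset.mem_filter, Finset.mem_univ, true_and] at hS
      rw [Finset.insert_erase (Finset.mem_erase.2 ⟨Ne.symm hxy, hS.2.2⟩),
        Finset.insert_erase hS.2.1]
  -- Step 3: the number of ordered pairs of distinct elements of `S`
  have h3 : ∀ (S : Finset Λ) (c : ℝ),
      (∑ x, ∑ y, (if x ≠ y ∧ x ∈ S ∧ y ∈ S then c else 0)) = S.card * ((S.card : ℝ) - 1) * c := by
    intro S c
    have hx : ∀ x, (∑ y, (if x ≠ y ∧ x ∈ S ∧ y ∈ S then c else 0)) =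
        if x ∈ S then ((S.card : ℝ) - 1) * c else 0 := by
      intro x
      by_cases hxS : x ∈ S
      · rw [if_pos hxS, ← Finset.sum_filter]
        have : (univ : Finset Λ).filter (fun y => x ≠ y ∧ x ∈ S ∧ y ∈ S) = S.erase x := by
          ext y
          simp only [Finset.mem_filter, Finset.mem_univ, true_and, Finset.mem_erase, hxS]
          tauto
        rw [this, Finset.sum_const, nsmul_eq_mul, Finset.cast_card_erase_of_mem hxS]
      · simp [hxS]
    simp only [hx]
    rw [Fintype.sum_ite_mem, Finset.sum_const, nsmul_eq_mul]
    ring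
  -- assemble
  rw [h1]
  calc (∑ T, ∑ x, ∑ y, (if x ∉ T ∧ y ∉ T ∧ x ≠ y then φ (insert x (insert y T)) ^ 2 else 0))
      = ∑ x, ∑ y, ∑ T, (if x ∉ T ∧ y ∉ T ∧ x ≠ y then φ (insert x (insert y T)) ^ 2 else 0) := by
        rw [Finset.sum_comm]
        exact Finset.sum_congr rfl fun x _ => Finset.sum_comm
    _ = ∑ x, ∑ y, ∑ S, (if x ≠ y ∧ x ∈ S ∧ y ∈ S then φ S ^ 2 else 0) := by simp only [h2]
    _ = ∑ x, ∑ S, ∑ y, (if x ≠ y ∧ x ∈ S ∧ y ∈ S then φ S ^ 2 else 0) :=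
        Finset.sum_congr rfl fun x _ => Finset.sum_comm
    _ = ∑ S, ∑ x, ∑ y, (if x ≠ y ∧ x ∈ S ∧ y ∈ S then φ S ^ 2 else 0) := Finset.sum_comm
    _ = ∑ S : Finset Λ, S.card * ((S.card : ℝ) - 1) * φ S ^ 2 :=
        Finset.sum_congr rfl fun S _ => h3 S _
    _ = (N : ℝ) * ((N : ℝ) - 1) * ∑ S, φ S ^ 2 := by
        rw [Finset.mul_sum]
        refine Finset.sum_congr rfl fun S _ => ?_
        by_cases hS : S.card = N
        · rw [hS]
        · rw [hφN S hS]
          ring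


/-- **`StableImpliesPairCoherence`** (item stmt-AtomisticToContinuum-9675, Brändén–Huh 2019,
Prop. 1.2 with Lemma 1.5, made quantitative): for `φ ≥ 0` supported on `N`-sets (`N ≥ 2`) with
`Σ_S φ(S) z^S` upper-half-plane stable,
`N(N-1) Σ_S φ(S)² ≤ Σ_{|T|=N-2} [Σ_x (r^T_x)³/R_T + (Σ_x (r^T_x)²)²/R_T²]`.
Double count (`sum_pairKernel_sq`), then for each `T` the Lorentzian Frobenius bound
(`sum_sq_le_of_quadratic_stable`) fed by `pairKernel_zero_or_stable`.
[cite: BrandenHuh2019, §1, Prop. 1.2 and Lemma 1.5] -/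
theorem stableImpliesPairCoherence :
    Summit.AtomisticToContinuum.BoseEinsteinCondensation.Theses.BECStronglyRayleigh.StableImpliesPairCoherence := by
  intro Λ _ _ N hN φ hφ0 hφN hstab
  dsimp only
  calc (N : ℝ) * ((N : ℝ) - 1) * ∑ S, φ S ^ 2
      = ∑ T ∈ (univ : Finset Λ).powersetCard (N - 2), ∑ x, ∑ y,
          (if x ∉ T ∧ y ∉ T ∧ x ≠ y then φ (insert x (insert y T)) else 0) ^ 2 :=
        (sum_pairKernel_sq hN hφN).symm
    _ ≤ _ := Finset.sum_le_sum fun T hT => ?_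
  refine sum_sq_le_of_quadratic_stable
    (fun x y => if x ∉ T ∧ y ∉ T ∧ x ≠ y then φ (insert x (insert y T)) else 0)
    (fun x y => ?_) (fun x y => ?_) (fun x => by simp)
    (pairKernel_zero_or_stable hN hφN hstab (Finset.mem_powersetCard_univ.1 hT))
  · -- symmetry
    show (if x ∉ T ∧ y ∉ T ∧ x ≠ y then φ (insert x (insert y T)) else 0) =
      (if y ∉ T ∧ x ∉ T ∧ y ≠ x then φ (insert y (insert x T)) else 0)
    rw [Finset.insert_comm x y T]
    by_cases h : x ∉ T ∧ y ∉ T ∧ x ≠ y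
    · rw [if_pos h, if_pos ⟨h.2.1, h.1, h.2.2.symm⟩]
    · rw [if_neg h, if_neg fun h' => h ⟨h'.2.1, h'.1, h'.2.2.symm⟩]
  · -- nonnegativity
    show 0 ≤ (if x ∉ T ∧ y ∉ T ∧ x ≠ y then φ (insert x (insert y T)) else 0)
    split_ifs
    · exact hφ0 _
    · exact le_rfl

end Summit.AtomisticToContinuum.BoseEinsteinCondensation.Theorems.PairCoherence

/-- **`StableImpliesPairCoherence`** — `Theorems`-namespace alias of
`PairCoherence.stableImpliesPairCoherence`, closing item stmt-AtomisticToContinuum-9675.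
[cite: BrandenHuh2019, §1, Prop. 1.2 and Lemma 1.5] -/
theorem Summit.AtomisticToContinuum.BoseEinsteinCondensation.Theorems.StableImpliesPairCoherence_proof :
    Summit.AtomisticToContinuum.BoseEinsteinCondensation.Theses.BECStronglyRayleigh.StableImpliesPairCoherence :=
  Summit.AtomisticToContinuum.BoseEinsteinCondensation.Theorems.PairCoherence.stableImpliesPairCoherence

end
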